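/-
Copyright (c) 2026 the pub-hodgecm-mathlib formalisation cell (harness21).  Prover seat hodgecm-mathlib-K2E3-p11 (g6), Track B «K2-LIT» ∕ h413
(`stmt-HodgeConjecture-24833`), line `K2_E3_EllipticInputs`, road (11-3-split-nsc) `sig_K2E3CharLocIntNearSemisimpleSplitThreeNonSupercuspidal` (U12 ED. 20 :419),
brick (nsc-K𝔭-AC-T), part 2∕2: (AC) FOR THE MAXIMAL PARABOLIC `P₍₁,₂₎ ⊂ GL₃(F)` AND FOR THE `Fin 3 → Fin 2`-LABELLED MAXIMAL PARABOLICS, hypothesis-free.  2026-09-04.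
-/
import Summits.HodgeConjecture.HodgeConjecture.Theorems.K2E3GL3KMUAbsContTransport       -- ★ part 1 (this seat): transport principle, the involution `θ`, membership transfers
import Summits.HodgeConjecture.HodgeConjecture.Theorems.K2E3GL3ParabolicKMUAbsCont       -- ★ p858599 (this seat): `parabolicKMU_null_of_haar_null` ((AC) for `![false,false,true]`)
import HarnessLib

/-!
# K2_E3 road (h413), (11-3-split-nsc) brick (nsc-K𝔭-AC-T), part 2∕2 — the `K M U` push-forward of the OTHER maximal parabolic `P₍₁,₂₎ ⊂ GL₃(F)` is absolutely
# continuous (transport of ★ (AC-P₂₁) along `θ(g) = w₀ (gᵀ)⁻¹ w₀`), and the `Fin 3 → Fin 2`-labelled forms of both maximal parabolics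

Cell `pub/hodgecm-mathlib` (D-0151), Track B, seat K2E3-p11 (g6) = road owner of (11-3-split-nsc) (BRICK LIST v2; bus 2026-09-04 ≈08:35Z «TAKING (AC-P₁₂) BY
TRANSPORT»).  `--supports stmt-HodgeConjecture-24833 --as helper`; THEOREMS ONLY (no definition ∕ instance ∕ notation ∕ named fact ∕ `sorry`); never imports
`Cruxes/…/Lines`.  COUNT-NEUTRAL.  Consumers: the (nsc-S-C′) interior road of K2E3-p24 (g0) («(AC-c) for BOTH two-block labels», bus 08:28:59Z; the `Fin 2`-labelled
form is the currency of ★ `bernsteinZelevinsky_support` ∕ ★ `exists_supercuspidal_injective_of_borel_subsingleton_three`) and any `Fin 2`-labelled use of ★ (nsc-vD-gen)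
`charLocIntNear_parabolicIndGL_of_ac` (its hypothesis `hAC` is exactly `parabolicKMU_null_of_haar_null_fin2 F c hc hcs μ₀`).

THE MATHEMATICS ([HarishChandra1970, Part V §4 Lemma 22]; [vanDijk1972, Thm. p. 237]; [BernsteinZelevinsky1977, §2.1]): ★ part 1 `kmuNull_of_continuousMulEquiv` with
`θ(g) = w₀ (gᵀ)⁻¹ w₀` (★ `exists_continuousMulEquiv_transposeInv_rev`; it preserves `GL₃(𝒪)` and exchanges `M₍₁,₂₎ ↔ M₍₂,₁₎`, `U₍₁,₂₎ ↔ U₍₂,₁₎`) moves ★ (AC-P₂₁)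
to `P₍₁,₂₎`; with `θ = id` it moves both across the relabelling `Fin 2 ↔ Bool` (the monotone surjective `c : Fin 3 → Fin 2` are `(0,0,1)`, `(0,1,1)`).

* **`parabolicKMU_null_of_haar_null_oneTwo`** — (AC) for the label `![false, true, true]`.
* **`parabolicKMU_null_of_haar_null_fin2`** — (AC) for every monotone surjective `c : Fin 3 → Fin 2`.

HONEST LABEL: HC_CM is proved only modulo the 7 printed citations (2 remaining named inputs: hLiu418 = stmt-HodgeConjecture-24832, h413 =
stmt-HodgeConjecture-24833) until rung 0 closes; count-neutral helper.

## References
* [HarishChandra1970] Harish-Chandra (notes by G. van Dijk), *Harmonic Analysis on Reductive p-adic Groups*, LNM 162 (1970), Part V §4 Lemma 22.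
* [vanDijk1972] G. van Dijk, *Computation of certain induced characters of 𝔭-adic groups*, Math. Ann. 199 (1972), Thm. p. 237.
* [BernsteinZelevinsky1977] I. N. Bernstein, A. V. Zelevinsky, *Induced representations of reductive 𝔭-adic groups I*, §2.1.
-/

set_option autoImplicit false
set_option linter.dupNamespace false

noncomputable section

open MeasureTheory MeasureTheory.Measure Set Function Topology Filter Matrix
open scoped NNReal ENNReal MatrixGroups Pointwise
open Literature.NumberTheory.GaloisRepresentations Literature.NumberTheory.GaloisRepresentations.IsNonarchimedeanLocalField
open Literature.NumberTheory.Automorphic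
open Summit.HodgeConjecture.HodgeConjecture.Cruxes.H413.K2E3GL3KMUAbsContTransport

namespace Summit.HodgeConjecture.HodgeConjecture.Cruxes.H413.K2E3GL3ParabolicKMUAbsContOneTwo

/-! ## §3  (AC) for `P₍₁,₂₎` and for the `Fin 2`-labelled maximal parabolics -/

/-- **(nsc-K𝔭-AC) FOR THE OTHER MAXIMAL PARABOLIC `P₍₁,₂₎` (label `![false, true, true]`), hypothesis-free**: for every Haar `μ₀` on `GL₃(F)`, all Haar measures `ν_M`
on `M₍₁,₂₎`, `μ_U` on `U₍₁,₂₎`, `μ_K` on `GL₃(𝒪)` and every measurable `μ₀`-null `A`, `(μ_K ⊗ (ν_M ⊗ μ_U)) {(k,m,u) | k⁻¹ (m u) k ∈ A} = 0` — ★ (AC-P₂₁)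
`parabolicKMU_null_of_haar_null` transported along the involution `θ(g) = w₀ (gᵀ)⁻¹ w₀` (§§1–2).  The hypothesis `hAC` of ★ (nsc-vD-gen) for this label.
[cite: HarishChandra1970, Part V §4 Lemma 22] [cite: vanDijk1972, Thm. p. 237] -/
theorem parabolicKMU_null_of_haar_null_oneTwo :
    ∀ (F : Type) [Field F] [ValuativeRel F] [TopologicalSpace F] [IsNonarchimedeanLocalField F]
      [MeasurableSpace (GL (Fin 3) F)] [BorelSpace (GL (Fin 3) F)] (μ₀ : Measure (GL (Fin 3) F)) [μ₀.IsHaarMeasure]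
      (νM : Measure ↥(standardLeviGL F (![false, true, true] : Fin 3 → Bool))) [νM.IsHaarMeasure]
      (μU : Measure ↥(unipotentRadicalGL F (![false, true, true] : Fin 3 → Bool))) [μU.IsHaarMeasure]
      (μK : Measure ↥(glInt 3 F)) [μK.IsHaarMeasure] (A : Set (GL (Fin 3) F)), MeasurableSet A → μ₀ A = 0 →
      (μK.prod (νM.prod μU)) {t : ↥(glInt 3 F) × (↥(standardLeviGL F (![false, true, true] : Fin 3 → Bool)) ×
          ↥(unipotentRadicalGL F (![false, true, true] : Fin 3 → Bool))) |
        ((t.1 : GL (Fin 3) F))⁻¹ * ((t.2.1 : GL (Fin 3) F) * (t.2.2 : GL (Fin 3) F)) * (t.1 : GL (Fin 3) F) ∈ A} = 0 := by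
  intro F _ _ _ _ _ _ μ₀ _ νM _ μU _ μK _ A hA hA0
  haveI : IsTopologicalRing F := inferInstance
  haveI : T2Space F := (isLocalField F).toT2Space
  haveI : T2Space (GL (Fin 3) F) := t2Space_generalLinearGroup F 3
  obtain ⟨θ, hθ, hθθ⟩ := exists_continuousMulEquiv_transposeInv_rev (F := F)
  exact kmuNull_of_continuousMulEquiv θ (isCompact_glInt (n := 3) (F := F)).isClosed
    (isClosed_standardLeviGL (R := F) _) (isClosed_unipotentRadicalGL (R := F) _)
    (mem_glInt_iff_of_entry θ hθ hθθ) (mem_standardLeviGL_oneTwo_iff_of_entry θ hθ hθθ) (mem_unipotentRadicalGL_oneTwo_iff_of_entry θ hθ hθθ) μ₀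
    (fun νM' _ μU' _ μK' _ A' hA' hA'0 => K2E3GL3ParabolicKMUAbsCont.parabolicKMU_null_of_haar_null F μ₀ νM' μU' μK' A' hA' hA'0)
    νM μU μK A hA hA0

/-- **(nsc-K𝔭-AC) FOR EVERY MAXIMAL STANDARD PARABOLIC OF `GL₃(F)`, `Fin 2`-LABELLED** (the currency of ★ `bernsteinZelevinsky_support` ∕ (S-C′)): for `c : Fin 3 → Fin 2`
monotone surjective (`c = (0,0,1)` or `(0,1,1)`), every Haar `μ₀`, all Haar measures on `M_c`, `U_c`, `GL₃(𝒪)` and every measurable `μ₀`-null `A`,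
`(μ_K ⊗ (ν_M ⊗ μ_U)) {(k,m,u) | k⁻¹ (m u) k ∈ A} = 0` — ★ (AC-P₂₁) resp. (AC-P₁₂) moved across the relabelling `Fin 2 ↔ Bool` by the `θ = id` case of §1.
[cite: HarishChandra1970, Part V §4 Lemma 22] [cite: vanDijk1972, Thm. p. 237] [cite: BernsteinZelevinsky1977, §2.1] -/
theorem parabolicKMU_null_of_haar_null_fin2 :
    ∀ (F : Type) [Field F] [ValuativeRel F] [TopologicalSpace F] [IsNonarchimedeanLocalField F]
      (c : Fin 3 → Fin 2), Monotone c → Function.Surjective c →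
      ∀ [MeasurableSpace (GL (Fin 3) F)] [BorelSpace (GL (Fin 3) F)] (μ₀ : Measure (GL (Fin 3) F)) [μ₀.IsHaarMeasure]
      (νM : Measure ↥(standardLeviGL F c)) [νM.IsHaarMeasure] (μU : Measure ↥(unipotentRadicalGL F c)) [μU.IsHaarMeasure]
      (μK : Measure ↥(glInt 3 F)) [μK.IsHaarMeasure] (A : Set (GL (Fin 3) F)), MeasurableSet A → μ₀ A = 0 →
      (μK.prod (νM.prod μU)) {t : ↥(glInt 3 F) × (↥(standardLeviGL F c) × ↥(unipotentRadicalGL F c)) |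
        ((t.1 : GL (Fin 3) F))⁻¹ * ((t.2.1 : GL (Fin 3) F) * (t.2.2 : GL (Fin 3) F)) * (t.1 : GL (Fin 3) F) ∈ A} = 0 := by
  intro F _ _ _ _ c hc hcs _ _ μ₀ _ νM _ μU _ μK _ A hA hA0
  haveI : IsTopologicalRing F := inferInstance
  haveI : T2Space F := (isLocalField F).toT2Space
  haveI : T2Space (GL (Fin 3) F) := t2Space_generalLinearGroup F 3
  have hKc : IsClosed (glInt 3 F : Set (GL (Fin 3) F)) := (isCompact_glInt (n := 3) (F := F)).isClosed
  rcases eq_of_monotone_surjective_fin2 c hc hcs with rfl | rfl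
  · exact kmuNull_of_continuousMulEquiv (ContinuousMulEquiv.refl _) hKc
      (isClosed_standardLeviGL (R := F) _) (isClosed_unipotentRadicalGL (R := F) _)
      (fun g => Iff.rfl) (fun g => (mem_standardLeviGL_fin2_iff_bool g).1) (fun g => (mem_unipotentRadicalGL_fin2_iff_bool g).1) μ₀
      (fun νM' _ μU' _ μK' _ A' hA' hA'0 => K2E3GL3ParabolicKMUAbsCont.parabolicKMU_null_of_haar_null F μ₀ νM' μU' μK' A' hA' hA'0)
      νM μU μK A hA hA0
  · exact kmuNull_of_continuousMulEquiv (ContinuousMulEquiv.refl _) hKc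
      (isClosed_standardLeviGL (R := F) _) (isClosed_unipotentRadicalGL (R := F) _)
      (fun g => Iff.rfl) (fun g => (mem_standardLeviGL_fin2_iff_bool g).2) (fun g => (mem_unipotentRadicalGL_fin2_iff_bool g).2) μ₀
      (fun νM' _ μU' _ μK' _ A' hA' hA'0 => parabolicKMU_null_of_haar_null_oneTwo F μ₀ νM' μU' μK' A' hA' hA'0)
      νM μU μK A hA hA0


end Summit.HodgeConjecture.HodgeConjecture.Cruxes.H413.K2E3GL3ParabolicKMUAbsContOneTwo

end
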